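import Summits.Ventures.HodgeRepro2.T5CyclotomicSevenPlaceCensus
import Summits.Ventures.HodgeRepro2.T5RecordSatakeSevenDegreeOne

/-!
# THE RECORD'S SPHERICAL HECKE ALGEBRA ON `ℚ(ζ₇)` IS COMMUTATIVE AT EVERY PLACE OF `ℚ(ζ₇)⁺` PRIME TO `7`

Tier-5 support N3 / §G-N4.2 (seat p3, gen 79). File 236 gives, for every CM field and every hermitian invertible
`3 × 3` Gram matrix, a FINITE set of places of `K⁺` outside which `H(U(1 ⊗ H), K_v)` is commutative. On the field of
record `ℚ(ζ₇)` with `H₀ = diag(1, 1, −1)` the census of file 266 makes the exceptional set EXPLICIT: it is contained in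
the places above `7`. Every place `v` of `ℚ(ζ₇)⁺` lies above a rational prime `p` (`exists_prime_liesOver`, any number
field), and for `p ≠ 7` the census puts `v` on one of two branches — `orderOf (p mod 7)` even: `v` stays prime and
`H(U(1 ⊗ H₀), K_v) ≃ k[X]` (file 236); odd: two places of `ℚ(ζ₇)` above `v` and the algebra is commutative (file 250):

* `exists_prime_liesOver` — every place of a number field lies above a rational prime (generic);
* `liesOver_of_map_eq` — `v 𝓞_K = w` ⟹ `w` lies over `v`; `exists_ne_liesOver_of_odd` — two distinct places above `v`
  when `orderOf (p mod 7)` is odd;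
* `heckeAlgebra_mul_comm_record_of_even`, `nonempty_algEquiv_polynomial_record_of_even`,
  `heckeAlgebra_mul_comm_record_of_odd` — the two branches;
* **`heckeAlgebra_mul_comm_record_seven`** — `H(U(1 ⊗ H₀), K_v)` is commutative at every place `v` of `ℚ(ζ₇)⁺` above
  a prime `p ≠ 7`; **`heckeAlgebra_mul_comm_record_seven_of_notMem`** — the intrinsic form: at every place `v` of
  `ℚ(ζ₇)⁺` with `7 ∉ v`;
* the split-completely instance `p = 29` (`orderOf (29 mod 7) = 1`): `exists_liesOver_twentynine_and_absNorm_eq`,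
  `ncard_primesOver_twentynine` (three places of `ℚ(ζ₇)⁺` above `29`, each of norm `29` with two places of `ℚ(ζ₇)`
  above it).

§8(d): uses an L-value-free non-vanishing device: NO.
-/

open Matrix NumberField NumberField.IsCMField IsDedekindDomain IsDedekindDomain.HeightOneSpectrum Module Polynomial
  MulAction
open scoped TensorProduct Pointwise
open Summit.Ventures.HodgeRepro2.T5UnitaryGroupForm Summit.Ventures.HodgeRepro2.T5UnitaryHeckeAdjoint
  Summit.Ventures.HodgeRepro2.T5HeckePermutationModule Summit.Ventures.HodgeRepro2.T5HeckeDoubleCoset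
  Summit.Ventures.HodgeRepro2.T5RecordHyperspecial Summit.Ventures.HodgeRepro2.T5GlobalLatticeAlmostAll
  Summit.Ventures.HodgeRepro2.T5FinitePlaceSplitClassification Summit.Ventures.HodgeRepro2.T5RecordSatakeIntrinsic
  Summit.Ventures.HodgeRepro2.T5CMFieldSquareDatum Summit.Ventures.HodgeRepro2.T5RecordSatakeToy
  Summit.Ventures.HodgeRepro2.T5RecordSatakeSplitToy Summit.Ventures.HodgeRepro2.T5SplitPlaceUnitaryGroup
  Summit.Ventures.HodgeRepro2.T5NonSplitPlaceUnitaryGroup Summit.Ventures.HodgeRepro2.T5FinitePlaceCM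
  Summit.Ventures.HodgeRepro2.T5StarOfInvolution Summit.Ventures.HodgeRepro2.T5RecordSatake
  Summit.Ventures.HodgeRepro2.T5RecordSatakeInert Summit.Ventures.HodgeRepro2.T5FinitePlaceSplitIff
  Summit.Ventures.HodgeRepro2.T5CyclotomicSevenInertThree Summit.Ventures.HodgeRepro2.T5CyclotomicSevenInertPrime
  Summit.Ventures.HodgeRepro2.T5CyclotomicSevenSplitTwo Summit.Ventures.HodgeRepro2.T5CyclotomicSevenSplitPrime
  Summit.Ventures.HodgeRepro2.T5CyclotomicSevenDegreeOnePrime Summit.Ventures.HodgeRepro2.T5CyclotomicSevenPlaceCensus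

namespace Summit.Ventures.HodgeRepro2.T5CyclotomicSevenHeckeCommutative

section Generic

/-- **Every place of a number field lies above a rational prime**: the contraction `v ∩ ℤ` is a non-zero prime ideal
of `ℤ`, generated by a prime `g`, and `(g) = (|g|)`. -/
theorem exists_prime_liesOver (F : Type*) [Field F] [NumberField F] (v : HeightOneSpectrum (𝓞 F)) :
    ∃ p : ℕ, p.Prime ∧ v.asIdeal.LiesOver (Ideal.span {(p : ℤ)}) := by
  obtain ⟨x, hxv, hx0⟩ := Submodule.exists_mem_ne_zero_of_ne_bot v.ne_bot
  have hI0 : v.asIdeal.under ℤ ≠ ⊥ :=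
    Ideal.comap_ne_bot_of_integral_mem hx0 hxv (Algebra.IsIntegral.isIntegral x)
  have hgen := Ideal.span_singleton_generator (v.asIdeal.under ℤ)
  have hg0 : Submodule.IsPrincipal.generator (v.asIdeal.under ℤ) ≠ 0 := by
    intro h
    rw [h, Ideal.span_singleton_zero] at hgen
    exact hI0 hgen.symm
  have hprime : Prime (Submodule.IsPrincipal.generator (v.asIdeal.under ℤ)) := by
    rw [← Ideal.span_singleton_prime hg0, hgen]
    exact Ideal.IsPrime.under ℤ v.asIdeal
  exact ⟨(Submodule.IsPrincipal.generator (v.asIdeal.under ℤ)).natAbs, Int.prime_iff_natAbs_prime.mp hprime,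
    ⟨(Ideal.span_singleton_eq_span_singleton.mpr (Int.associated_natAbs _).symm).trans hgen⟩⟩

end Generic

section Seven

variable (K : Type*) [Field K] [CharZero K] [IsCyclotomicExtension {7} ℚ K]

omit [CharZero K] [IsCyclotomicExtension {7} ℚ K] in
/-- `v 𝓞_K = w` ⟹ `w` lies over `v` (`v ≤ v 𝓞_K ∩ 𝓞_{K⁺} = w ∩ 𝓞_{K⁺}`, a proper ideal, and `v` is maximal). -/
theorem liesOver_of_map_eq [NumberField K] (v : HeightOneSpectrum (𝓞 (maximalRealSubfield K)))
    (w : HeightOneSpectrum (𝓞 K))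
    (hmap : Ideal.map (algebraMap (𝓞 (maximalRealSubfield K)) (𝓞 K)) v.asIdeal = w.asIdeal) :
    w.asIdeal.LiesOver v.asIdeal := by
  have hle : v.asIdeal ≤ Ideal.comap (algebraMap (𝓞 (maximalRealSubfield K)) (𝓞 K)) w.asIdeal := by
    rw [← hmap]
    exact Ideal.le_comap_map
  exact ⟨v.isMaximal.eq_of_le (Ideal.comap_ne_top _ w.isPrime.ne_top) hle⟩

variable (p : ℕ) [hp : Fact p.Prime] (h7 : ¬ p ∣ 7)
variable (v : HeightOneSpectrum (𝓞 (maximalRealSubfield K))) [hv : v.asIdeal.LiesOver (Ideal.span {(p : ℤ)})]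
include hv h7

/-- **Two distinct places of `ℚ(ζ₇)` above `v` when `orderOf (p mod 7)` is odd** (file 266's
`ncard_primesOver_eq_two_iff_odd`). -/
theorem exists_ne_liesOver_of_odd (hodd : Odd (orderOf (p : ZMod 7))) :
    haveI := numberField' K; haveI := isCMField' K
    ∃ w₁ w₂ : HeightOneSpectrum (𝓞 K), w₁ ≠ w₂ ∧ w₁.asIdeal.LiesOver v.asIdeal ∧
      w₂.asIdeal.LiesOver v.asIdeal := by
  haveI := numberField' K
  haveI := isCMField' K
  obtain ⟨x, z, hxz, hs⟩ := Set.ncard_eq_two.mp ((ncard_primesOver_eq_two_iff_odd K p h7 v).mpr hodd)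
  have hx : x ∈ v.asIdeal.primesOver (𝓞 K) := by rw [hs]; exact Set.mem_insert x _
  have hz : z ∈ v.asIdeal.primesOver (𝓞 K) := by rw [hs]; exact Set.mem_insert_of_mem x rfl
  haveI := hx.1
  haveI := hx.2
  haveI := hz.1
  haveI := hz.2
  refine ⟨⟨x, hx.1, Ideal.ne_bot_of_liesOver_of_ne_bot v.ne_bot x⟩,
    ⟨z, hz.1, Ideal.ne_bot_of_liesOver_of_ne_bot v.ne_bot z⟩, ?_, hx.2, hz.2⟩
  intro h
  exact hxz (congrArg HeightOneSpectrum.asIdeal h)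

/-- **The odd branch: `H(U(1 ⊗ H₀), K_v)` is commutative when `orderOf (p mod 7)` is odd** (two places above `v`;
file 250's `heckeAlgebra_mul_comm_record_of_ne_of_liesOver`). -/
theorem heckeAlgebra_mul_comm_record_of_odd (hodd : Odd (orderOf (p : ZMod 7))) (k : Type*) [Field k] {r : ℕ}
    (l : Fin r → 𝓞 K) (hl : Submodule.span (𝓞 (maximalRealSubfield K)) (Set.range l) = ⊤)
    (T S : (haveI := numberField' K; haveI := isCMField' K; letI := tensorStarRing K v;
      ↥(heckeAlgebra k (recordHyperspecial K v l (gramToy K))))) :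
    T * S = S * T :=
  haveI := numberField' K
  haveI := isCMField' K
  (exists_ne_liesOver_of_odd K p h7 v hodd).elim fun w₁ h => h.elim fun w₂ h =>
    @heckeAlgebra_mul_comm_record_of_ne_of_liesOver K _ (numberField' K) (isCMField' K) v w₁ w₂ _ l k _ hl h.1
      h.2.1 h.2.2 _ _ _ _ gramToy_isHermitian isUnit_det_gramToy (notMem_badSet_gramToy _) T S

/-- **The even branch: `H(U(1 ⊗ H₀), K_v)` is commutative when `orderOf (p mod 7)` is even** (`v` stays prime; file
236's `heckeAlgebra_mul_comm_record_of_staysPrime`). -/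
theorem heckeAlgebra_mul_comm_record_of_even (heven : Even (orderOf (p : ZMod 7))) (k : Type*) [Field k] {r : ℕ}
    (l : Fin r → 𝓞 K) (hl : Submodule.span (𝓞 (maximalRealSubfield K)) (Set.range l) = ⊤)
    (T S : (haveI := numberField' K; haveI := isCMField' K; letI := tensorStarRing K v;
      ↥(heckeAlgebra k (recordHyperspecial K v l (gramToy K))))) :
    T * S = S * T :=
  haveI := numberField' K
  haveI := isCMField' K
  ((exists_map_eq_iff_even K p h7 v).mpr heven).elim fun w hmap =>
    @T5RecordSatakeIntrinsic.heckeAlgebra_mul_comm_record_of_staysPrime K _ (numberField' K) (isCMField' K) v w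
      (liesOver_of_map_eq K v w hmap) _ l k _ hl hmap _ gramToy_isHermitian isUnit_det_gramToy
      (notMem_badSet_gramToy _) T S

/-- **The even branch is `k[X]`**: `H(U(1 ⊗ H₀), K_v) ≃ k[X]` when `orderOf (p mod 7)` is even (file 236's
`nonempty_algEquiv_polynomial_record_of_staysPrime`). -/
theorem nonempty_algEquiv_polynomial_record_of_even (heven : Even (orderOf (p : ZMod 7))) (k : Type*) [Field k]
    {r : ℕ} (l : Fin r → 𝓞 K) (hl : Submodule.span (𝓞 (maximalRealSubfield K)) (Set.range l) = ⊤) :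
    haveI := numberField' K; haveI := isCMField' K
    Nonempty (Polynomial k ≃ₐ[k]
      (letI := tensorStarRing K v; ↥(heckeAlgebra k (recordHyperspecial K v l (gramToy K))))) :=
  haveI := numberField' K
  haveI := isCMField' K
  ((exists_map_eq_iff_even K p h7 v).mpr heven).elim fun w hmap =>
    @T5RecordSatakeIntrinsic.nonempty_algEquiv_polynomial_record_of_staysPrime K _ (numberField' K) (isCMField' K)
      v w (liesOver_of_map_eq K v w hmap) _ l k _ hl hmap _ gramToy_isHermitian isUnit_det_gramToy
      (notMem_badSet_gramToy _)

/-- **THE RECORD'S SPHERICAL HECKE ALGEBRA ON `ℚ(ζ₇)` IS COMMUTATIVE AT EVERY PLACE OF `ℚ(ζ₇)⁺` ABOVE A PRIME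
`p ≠ 7`**, for every family `l` of generators of `𝓞_{ℚ(ζ₇)}` over `𝓞_{ℚ(ζ₇)⁺}` and every field `k`: the two branches of
the census. -/
theorem heckeAlgebra_mul_comm_record_seven (k : Type*) [Field k] {r : ℕ} (l : Fin r → 𝓞 K)
    (hl : Submodule.span (𝓞 (maximalRealSubfield K)) (Set.range l) = ⊤)
    (T S : (haveI := numberField' K; haveI := isCMField' K; letI := tensorStarRing K v;
      ↥(heckeAlgebra k (recordHyperspecial K v l (gramToy K))))) :
    T * S = S * T :=
  haveI := numberField' K
  haveI := isCMField' K
  (Nat.even_or_odd (orderOf (p : ZMod 7))).elim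
    (fun h => ((exists_map_eq_iff_even K p h7 v).mpr h).elim fun w hmap =>
      @T5RecordSatakeIntrinsic.heckeAlgebra_mul_comm_record_of_staysPrime K _ (numberField' K) (isCMField' K) v w
        (liesOver_of_map_eq K v w hmap) _ l k _ hl hmap _ gramToy_isHermitian isUnit_det_gramToy
        (notMem_badSet_gramToy _) T S)
    (fun h => (exists_ne_liesOver_of_odd K p h7 v h).elim fun w₁ h => h.elim fun w₂ h =>
      @heckeAlgebra_mul_comm_record_of_ne_of_liesOver K _ (numberField' K) (isCMField' K) v w₁ w₂ _ l k _ hl h.1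
        h.2.1 h.2.2 _ _ _ _ gramToy_isHermitian isUnit_det_gramToy (notMem_badSet_gramToy _) T S)

end Seven

section Intrinsic

variable (K : Type*) [Field K] [CharZero K] [IsCyclotomicExtension {7} ℚ K]
variable (v : HeightOneSpectrum (𝓞 (maximalRealSubfield K)))

omit [CharZero K] [IsCyclotomicExtension {7} ℚ K] in
/-- If `v` lies above `p` and `7 ∉ v`, then `p ∤ 7`. -/
theorem not_dvd_seven_of_notMem [NumberField K] (p : ℕ) [hp : Fact p.Prime]
    [hv : v.asIdeal.LiesOver (Ideal.span {(p : ℤ)})] (h7 : (7 : 𝓞 (maximalRealSubfield K)) ∉ v.asIdeal) :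
    ¬ p ∣ 7 := by
  intro hdvd
  rcases (Nat.prime_seven.eq_one_or_self_of_dvd p hdvd) with h | h
  · exact hp.out.one_lt.ne' h
  · apply h7
    have hmem : (p : ℤ) ∈ Ideal.span {(p : ℤ)} := Ideal.mem_span_singleton_self (p : ℤ)
    rw [Ideal.mem_of_liesOver v.asIdeal (Ideal.span {(p : ℤ)}) p, map_natCast, h, Nat.cast_ofNat] at hmem
    exact hmem

/-- **THE INTRINSIC FORM: `H(U(1 ⊗ H₀), K_v)` IS COMMUTATIVE AT EVERY PLACE `v` OF `ℚ(ζ₇)⁺` WITH `7 ∉ v`** — the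
explicit exceptional set of file 236's census on the field of record: at most the places above `7`. -/
theorem heckeAlgebra_mul_comm_record_seven_of_notMem (h7 : (7 : 𝓞 (maximalRealSubfield K)) ∉ v.asIdeal)
    (k : Type*) [Field k] {r : ℕ} (l : Fin r → 𝓞 K)
    (hl : Submodule.span (𝓞 (maximalRealSubfield K)) (Set.range l) = ⊤)
    (T S : (haveI := numberField' K; haveI := isCMField' K; letI := tensorStarRing K v;
      ↥(heckeAlgebra k (recordHyperspecial K v l (gramToy K))))) :
    T * S = S * T :=
  haveI := numberField' K
  haveI := isCMField' K
  (exists_prime_liesOver (maximalRealSubfield K) v).elim fun p h =>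
    haveI : Fact p.Prime := ⟨h.1⟩
    haveI := h.2
    heckeAlgebra_mul_comm_record_seven K p (not_dvd_seven_of_notMem K v p h7) v k l hl T S

end Intrinsic

section TwentyNine

variable (K : Type*) [Field K] [CharZero K] [IsCyclotomicExtension {7} ℚ K]

/-- `29 ≡ 1 (mod 7)` has multiplicative order `1`. -/
theorem orderOf_twentynine_zmod_seven : orderOf (29 : ZMod 7) = 1 := by
  rw [orderOf_eq_one_iff]
  decide

/-- `orderOf ((29 : ℕ) : ZMod 7) = 1` (the cast form used by the generic theorems). -/
theorem orderOf_natCast_twentynine_zmod_seven : orderOf ((29 : ℕ) : ZMod 7) = 1 := by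
  rw [Nat.cast_ofNat]
  exact orderOf_twentynine_zmod_seven

/-- `29` is prime (as a `Fact`, for the generic theorems). -/
theorem fact_prime_twentynine : Fact (Nat.Prime 29) := ⟨by norm_num⟩

/-- `29 ∤ 7`. -/
theorem not_twentynine_dvd_seven : ¬ (29 : ℕ) ∣ 7 := by norm_num

/-- **The split-completely instance `p = 29`**: a place `v` of `ℚ(ζ₇)⁺` above `29` of norm `29` with exactly two
places of `ℚ(ζ₇)` above it. -/
theorem exists_liesOver_twentynine_and_absNorm_eq :
    haveI := numberField' K; haveI := isCMField' K
    ∃ v : HeightOneSpectrum (𝓞 (maximalRealSubfield K)), v.asIdeal.LiesOver (Ideal.span {(29 : ℤ)}) ∧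
      Ideal.absNorm v.asIdeal = 29 ∧ (v.asIdeal.primesOver (𝓞 K)).ncard = 2 := by
  haveI := numberField' K
  haveI := isCMField' K
  haveI := fact_prime_twentynine
  haveI : (Ideal.span {(29 : ℤ)}).IsPrime := (Ideal.span_singleton_prime (by norm_num)).mpr (by norm_num)
  obtain ⟨⟨Q, hQ, hQo⟩⟩ := Ideal.nonempty_primesOver (S := 𝓞 (maximalRealSubfield K)) (Ideal.span {(29 : ℤ)})
  haveI := hQ
  haveI := hQo
  have hQo' : Q.LiesOver (Ideal.span {((29 : ℕ) : ℤ)}) := by rwa [Nat.cast_ofNat]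
  have hne : Q ≠ ⊥ := Ideal.ne_bot_of_liesOver_of_ne_bot
    ((Ideal.span_singleton_eq_bot).not.mpr (by norm_num : (29 : ℤ) ≠ 0)) Q
  refine ⟨⟨Q, hQ, hne⟩, hQo, ?_, ?_⟩
  · have h := absNorm_eq_pow_gcd K 29 (hp := fact_prime_twentynine) not_twentynine_dvd_seven ⟨Q, hQ, hne⟩
      (hv := hQo')
    rwa [orderOf_natCast_twentynine_zmod_seven, show Nat.gcd 1 3 = 1 from rfl, pow_one] at h
  · refine (ncard_primesOver_eq_two_iff_odd K 29 (hp := fact_prime_twentynine) not_twentynine_dvd_seven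
      ⟨Q, hQ, hne⟩ (hv := hQo')).mpr ?_
    rw [orderOf_natCast_twentynine_zmod_seven]
    exact odd_one

/-- **Exactly three places of `ℚ(ζ₇)⁺` above `29`** (`gcd(1, 3) = 1`). -/
theorem ncard_primesOver_twentynine :
    haveI := numberField' K; haveI := isCMField' K
    ((Ideal.span {(29 : ℤ)}).primesOver (𝓞 (maximalRealSubfield K))).ncard = 3 := by
  haveI := numberField' K
  haveI := isCMField' K
  haveI := fact_prime_twentynine
  haveI : (Ideal.span {(29 : ℤ)}).IsPrime := (Ideal.span_singleton_prime (by norm_num)).mpr (by norm_num)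
  obtain ⟨⟨Q, hQ, hQo⟩⟩ := Ideal.nonempty_primesOver (S := 𝓞 (maximalRealSubfield K)) (Ideal.span {(29 : ℤ)})
  haveI := hQ
  haveI := hQo
  have hQo' : Q.LiesOver (Ideal.span {((29 : ℕ) : ℤ)}) := by rwa [Nat.cast_ofNat]
  have hne : Q ≠ ⊥ := Ideal.ne_bot_of_liesOver_of_ne_bot
    ((Ideal.span_singleton_eq_bot).not.mpr (by norm_num : (29 : ℤ) ≠ 0)) Q
  have h := ncard_primesOver_int_mul_gcd K 29 (hp := fact_prime_twentynine) not_twentynine_dvd_seven ⟨Q, hQ, hne⟩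
    (hv := hQo')
  rwa [orderOf_natCast_twentynine_zmod_seven, show Nat.gcd 1 3 = 1 from rfl, mul_one, Nat.cast_ofNat] at h

end TwentyNine

end Summit.Ventures.HodgeRepro2.T5CyclotomicSevenHeckeCommutative
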